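import Mathlib
import Literature.NumberTheory.LFunctions.Zhang2022.Section17Eval1710Rel
import Literature.NumberTheory.LFunctions.Zhang2022.SkeletonEvalRelE
import Literature.NumberTheory.LFunctions.Zhang2022.TypedSection17RelE
import HarnessLib

/-!
# Zhang (2022) §17 (17.10) in the relative reading AT THE RT-05 PARAMETER: the producing E-edge
# `Eq17_1 → (17.6)ᴿ → (17.9)ᴿ[e1pp] → Eval1710RelE e1pp` (ZHANG-L R-28; pen copy-proof, constant-agnostic)

Topic `Literature/NumberTheory/LFunctions/Zhang2022` (Landau–Siegel audit tree; verdict-neutral).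
Y. Zhang, *Discrete mean estimates and the Landau–Siegel zero*, arXiv:2211.02515v1 (2022)
[Zhang2022LandauSiegel] — **an unrefereed manuscript under adjudication**; the displays are CLAIM nodes,
stated not asserted. THEOREMS ONLY: the §17 producing edge of the skeleton's E-chain (`SkeletonEvalRelE`,
p477046), i.e. `Phi3Eval.eval1710Rel_of_rel` (Section17Eval1710Rel) re-run VERBATIM with the constant
`𝔢₁ = frake 1` replaced by the parameter `𝔢₁[e1pp] = frakeE e1pp 1` (RT-05: `frake = frakeE e1ppj`,
instance of record `e1ppD`; the proof never inspects the value — R-28 C4). Inputs: `Typed.Section17.Eq17_1`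
((17.1), `O(e^{−c𝓛¹⁰})`), `Typed.Section17.Eq17_6Rel` ((17.6)ᴿ, `𝔢₀` only — no twin needed) and the leaf
twin `Typed.Section17.Eq17_9RelE e1pp` (TypedSection17RelE, p477021); conclusion `Skeleton.Eval1710RelE e1pp c′`
BY NAME. Also `eq17_9RelE_of_abs`: an absolute (17.9) at `𝔢₁[e1pp]` implies the relative leaf twin
(`εp ≤ ε(𝔞+1)p`). Nothing about Theorems 1–2 of the source is implied.

## References

* Y. Zhang, arXiv:2211.02515v1 (2022), §17 (17.1), (17.6), (17.9), (17.10) pp. 95–99.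
  [cite: Zhang2022LandauSiegel, §17 (17.10) p.99]
-/

noncomputable section

open Complex Real
open Literature.NumberTheory.LFunctions.Zhang2022
open Literature.NumberTheory.LFunctions.Zhang2022.Skeleton
open Literature.NumberTheory.LFunctions.Zhang2022.Typed.Section17

namespace Literature.NumberTheory.LFunctions.Zhang2022.Phi3Eval

/-- **An absolute (17.9) at the parameter implies the relative leaf twin**: if
`‖Σ_{ψ∈Ψ₁}(p_ψt₀)^{β₃}I₄⁻(ψ) − 𝔢₁[e1pp]𝔞𝔓‖ ≤ ε𝔓` eventually for every `ε > 0`, then `Eq17_9RelE e1pp c′`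
(`ε𝔓 ≤ ε(𝔞+1)𝔓`, `𝔞 ≥ 0`). [cite: Zhang2022LandauSiegel, §17 (17.9) p.98] -/
theorem eq17_9RelE_of_abs (e1pp : ℕ → ℂ) {c' : ℝ}
    (h9 : ∀ ε : ℝ, 0 < ε → ForAllLarge fun D _ χ => AssumptionA D χ →
      ‖(∑ x ∈ finsetOf (PsiOne χ), (((x.p : ℝ) * t0 D : ℝ) : ℂ) ^ beta3 c' D * I4 c' χ x (-alpha D)) -
          frakeE e1pp 1 * frakA χ * frakP D‖ ≤ ε * frakP D) :
    Eq17_9RelE e1pp c' := fun ε hε =>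
  (h9 ε hε).mono fun D _ χ _ _ hS hA => by
    have h := hS hA
    have hA0 : 0 ≤ frakA χ := frakA_nonneg χ
    have hP0 : 0 ≤ frakP D := frakP_nonneg D
    nlinarith [mul_nonneg (mul_nonneg hε.le hA0) hP0]

/-- **(17.10)ᴿ at the parameter `e″ = e1pp` from (17.1), (17.6)ᴿ and (17.9)ᴿ[e1pp]** (§17 p. 99:
"Finally, from (17.1), (17.6) and (17.9) we conclude (17.10)"): the skeleton's E-chain node
`Skeleton.Eval1710RelE e1pp c′` BY NAME — `eval1710Rel_of_rel` with `𝔢₁ ↦ 𝔢₁[e1pp]`, verbatim.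
[cite: Zhang2022LandauSiegel, §17 (17.10) p.99] -/
theorem eval1710RelE_of_rel (e1pp : ℕ → ℂ) {c' : ℝ} (h1 : Eq17_1 c') (h6 : Eq17_6Rel c')
    (h9 : Eq17_9RelE e1pp c') : Eval1710RelE e1pp c' := by
  have h6R := (eq17_6Rel_iff c').mp h6
  have h9R : ∀ ε : ℝ, 0 < ε → ForAllLarge fun D _ χ => AssumptionA D χ →
      ‖(∑ x ∈ finsetOf (PsiOne χ), (((x.p : ℝ) * t0 D : ℝ) : ℂ) ^ beta3 c' D * I4 c' χ x (-alpha D)) -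
          frakeE e1pp 1 * frakA χ * frakP D‖ ≤ ε * (frakA χ + 1) * frakP D := h9
  intro ε hε
  obtain ⟨c₀, hc₀, C, hC⟩ := h1
  have hε3 : 0 < ε / 3 := by positivity
  obtain ⟨D₀, hall⟩ :=
    (((hC.and (h6R _ hε3)).and (h9R _ hε3)).and forAllLarge_self_le_frakP).and
      (forAllLarge_le_ell (3 * |C| / ε + 1))
  refine ⟨D₀, fun D _ χ hD hq hp hA => ?_⟩
  obtain ⟨⟨⟨⟨e1, e6⟩, e9⟩, hPD⟩, hℓ⟩ := hall D χ hD hq hp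
  set Xp : ℂ := ∑ x ∈ finsetOf (PsiOne χ),
    (((x.p : ℝ) * t0 D : ℝ) : ℂ) ^ beta3 c' D * I4 c' χ x (alpha D) with hXp
  set Xm : ℂ := ∑ x ∈ finsetOf (PsiOne χ),
    (((x.p : ℝ) * t0 D : ℝ) : ℂ) ^ beta3 c' D * I4 c' χ x (-alpha D) with hXm
  have hPnn : 0 ≤ frakP D := frakP_nonneg D
  have hA0 : 0 ≤ frakA χ := frakA_nonneg χ
  have hAP : frakP D ≤ (frakA χ + 1) * frakP D := by nlinarith
  have hsum : ∑ x ∈ finsetOf (PsiOne χ), (((x.p : ℝ) * t0 D : ℝ) : ℂ) ^ beta3 c' D *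
      (I4 c' χ x (alpha D) - I4 c' χ x (-alpha D)) = Xp - Xm := by
    rw [hXp, hXm, ← Finset.sum_sub_distrib]
    exact Finset.sum_congr rfl fun x _ => by ring
  have hb1 : ‖Phi3 c' χ - (Xp - Xm)‖ ≤ ε / 3 * ((frakA χ + 1) * frakP D) := by
    have h1' : ‖Phi3 c' χ - (Xp - Xm)‖ ≤ C * Real.exp (-c₀ * ell D ^ 10) := by
      rw [← hsum]; exact e1 hA
    have hℓ0 : 0 < ell D := by
      have : 0 ≤ 3 * |C| / ε := by positivity
      linarith
    have hexp : Real.exp (-c₀ * ell D ^ 10) ≤ 1 := by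
      rw [Real.exp_le_one_iff]
      have : 0 ≤ ell D ^ 10 := by positivity
      nlinarith
    have h2 : C * Real.exp (-c₀ * ell D ^ 10) ≤ |C| :=
      (le_abs_self _).trans (by
        rw [abs_mul, abs_of_nonneg (Real.exp_nonneg _)]
        exact mul_le_of_le_one_right (abs_nonneg _) hexp)
    have hDpos : (0 : ℝ) < D := by exact_mod_cast Nat.pos_of_ne_zero (NeZero.ne D)
    have hℓD : ell D ≤ D := (Real.log_le_sub_one_of_pos hDpos).trans (by linarith)
    have h3 : |C| ≤ ε / 3 * ell D := by
      have : 3 * |C| / ε ≤ ell D := by linarith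
      rw [div_le_iff₀ hε] at this
      linarith
    have h4 : |C| ≤ ε / 3 * ((frakA χ + 1) * frakP D) :=
      h3.trans (mul_le_mul_of_nonneg_left ((hℓD.trans hPD).trans hAP) hε3.le)
    linarith
  have hb2 : ‖Xp + frake0 * frakA χ * frakP D‖ ≤ ε / 3 * (frakA χ + 1) * frakP D := e6 hA
  have hb3 : ‖Xm - frakeE e1pp 1 * frakA χ * frakP D‖ ≤ ε / 3 * (frakA χ + 1) * frakP D := e9 hA
  have hsplit : Phi3 c' χ + (frake0 + frakeE e1pp 1) * frakA χ * frakP D =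
      (Phi3 c' χ - (Xp - Xm)) + (Xp + frake0 * frakA χ * frakP D) -
        (Xm - frakeE e1pp 1 * frakA χ * frakP D) := by ring
  rw [hsplit]
  calc ‖(Phi3 c' χ - (Xp - Xm)) + (Xp + frake0 * frakA χ * frakP D) -
        (Xm - frakeE e1pp 1 * frakA χ * frakP D)‖
      ≤ ‖Phi3 c' χ - (Xp - Xm)‖ + ‖Xp + frake0 * frakA χ * frakP D‖ +
        ‖Xm - frakeE e1pp 1 * frakA χ * frakP D‖ :=
          (norm_sub_le _ _).trans (add_le_add (norm_add_le _ _) le_rfl)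
    _ ≤ ε / 3 * ((frakA χ + 1) * frakP D) + ε / 3 * (frakA χ + 1) * frakP D +
        ε / 3 * (frakA χ + 1) * frakP D := add_le_add (add_le_add hb1 hb2) hb3
    _ = ε * (frakA χ + 1) * frakP D := by ring


/-- Consistency at the stated constants: the banked relative edge is the instance `e1pp = e1ppj`
(`Eq17_9RelE e1ppj = Eq17_9Rel`, `Eval1710RelE e1ppj ↔ Eval1710Rel` by `rfl`/`Iff.rfl`).
[cite: Zhang2022LandauSiegel, §17 (17.10) p.99] -/
theorem eval1710Rel_of_relE_e1ppj {c' : ℝ} (h1 : Eq17_1 c') (h6 : Eq17_6Rel c') (h9 : Eq17_9Rel c') :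
    Eval1710Rel c' :=
  (eval1710RelE_e1ppj_iff c').mp (eval1710RelE_of_rel e1ppj h1 h6 h9)

end Literature.NumberTheory.LFunctions.Zhang2022.Phi3Eval
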